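import Literature.NumberTheory.LFunctions.RiemannSiegelPhase
import Literature.NumberTheory.LFunctions.RiemannSiegelStirling
import Literature.Analysis.SpecialFunctions.DigammaStirlingSecondOrder
import Literature.NumberTheory.LFunctions.ZetaCertifiedEvaluation

/-!
# RiemannHypothesis / UniversalFactor — definitions of the Lehmer-pair certificate for `LehmerPointNoGo`

Route `RiemannHypothesis/UniversalFactor`, item `LehmerPointNoGo` (stmt-RiemannHypothesis-2582):
`F_16(z) = ∫₀^∞ Φ(u)(1 + u²/16²)⁻¹ cos(zu) du` has a non-real zero.  The proof is a certified
computation (the Laguerre one-point dip certificate `UniversalFactor.not_hasOnlyRealZeros_of_dip_certificate`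
of `UniversalFactorLaguerreCriterion.lean` at `x₀ = 2t₀`, `t₀ = 7005.08`, Lehmer's pair).  This file
collects the DEFINITIONS the certificate posits (no theorems; their theory is in the
`UniversalFactorLehmer*.lean` proof files):

* analytic objects: `thetaMain` (Stirling main term of `θ`), `lehmerK0` (`K₀ = π^{-1/4}|Γ(¼+it₀/2)|/16`),
  `lehmerCore`, `lehmerF` (the explicit holomorphic multiple of `ζ` whose real part on the critical
  line is `−H_0(2t)e^{−κ(t−t₀)}/K₀` up to `1 ± 10⁻⁷`), `lehmerPhaseErr`, `lehmerSegErr` (Stirling error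
  terms), `lehmerTailConst`, `quadDefect`, `lehmerMdisc`, `lehmerMseg` (error-bound constants),
  `ellR`, `alphaR`, `reSPR`, `imSPR` (`F(¼+it/2)` in real terms, `F = stirlingPrim`);
* executable interval arithmetic (multi-precision intervals `MI`/`MC` of
  `Literature/Analysis/ValidatedNumerics/MultiPrecisionInterval.lean`, certified `ζ` of
  `ZetaCertifiedEvaluation.lean`): `atanSmall`, `ellOf`, `alphaOf`, `spOf`, the evaluation context
  `LCtx`/`LCtx.Valid`/`mkCtx`, `KEXP`, `kEXP`, and `lehmerFBox` (a complex box for `lehmerF t₀ κ (½+it)`).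

References: N. G. de Bruijn, Duke Math. J. 17 (1950); G. Csordas, W. Smith, R. S. Varga, Constr.
Approx. 10 (1994); E. C. Titchmarsh, *The Theory of the Riemann Zeta-Function* (1986), §4.17.
-/

noncomputable section

set_option linter.dupNamespace false

namespace Summit.RiemannHypothesis.RiemannHypothesis.Theorems

open Complex Real Finset
open Literature.NumberTheory.LFunctions Literature.NumberTheory.LFunctions.ZetaNumerics
open Literature.Analysis.SpecialFunctions.Complex (stirlingPrim)
open Literature.Analysis.ValidatedNumerics Literature.Analysis.ValidatedNumerics.NumericsMP

/-- Stirling's main term for `θ(t)`: `φ(t) = (t/2) log(t/2π) − t/2 − π/8`. [folklore] -/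
def UniversalFactor.thetaMain (t : ℝ) : ℝ := t / 2 * Real.log (t / (2 * π)) - t / 2 - π / 8

/-- The normalising constant `K₀(t₀) = π^{-1/4} |Γ(¼ + it₀/2)| / 16 > 0`. [folklore] -/
def UniversalFactor.lehmerK0 (t₀ : ℝ) : ℝ :=
  Real.exp (-Real.log π / 4) * ‖Complex.Gamma (thetaArg t₀)‖ / 16

/-- The explicit analytic factor times `ζ`:
`lehmerCore t₀ s = s(1−s) · e^{iφ(t₀)} · e^{−((s−s₀)/2) log π} · e^{F(s/2) − F(¼+it₀/2)} · ζ(s)`,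
`s₀ = ½ + it₀`, `F = stirlingPrim`. [folklore] -/
def UniversalFactor.lehmerCore (t₀ : ℝ) (s : ℂ) : ℂ :=
  s * (1 - s) * cexp (UniversalFactor.thetaMain t₀ * I) *
    cexp (-((s - (1 / 2 + t₀ * I)) / 2) * Real.log π) *
    cexp (stirlingPrim (s / 2) - stirlingPrim (thetaArg t₀)) * riemannZeta s

/-- The phase error bound `d(t₀) = 2K(¼)/t₀ ≥ |θ(t₀) − φ(t₀)|` (`t₀ ≥ 2`). [folklore] -/
def UniversalFactor.lehmerPhaseErr (t₀ : ℝ) : ℝ := 2 * stirlingVertRate (1 / 4) / t₀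

/-- The segment Stirling error `e(t₀, t) = 2(1/(6b³) + π/(12b²)) · |t − t₀|/2`, `b = min(t,t₀)/2`.
[folklore] -/
def UniversalFactor.lehmerSegErr (t₀ t : ℝ) : ℝ :=
  2 * (1 / (6 * (min t t₀ / 2) ^ 3) + π / (12 * (min t t₀ / 2) ^ 2)) * (|t - t₀| / 2)

/-- `lehmerF t₀ κ s = lehmerCore t₀ s · exp(κ i (s − (½ + it₀)))`; on the critical line
`s = ½ + it` the weight is the real number `e^{−κ(t − t₀)}`. [folklore] -/
def UniversalFactor.lehmerF (t₀ κ : ℝ) (s : ℂ) : ℂ :=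
  UniversalFactor.lehmerCore t₀ s * cexp (κ * I * (s - (1 / 2 + t₀ * I)))

/-- The constant `C(t₀) = 5 exp(log(t₀/2)/4 + 3/64 + π/4 + 1)` of the tail bounds. [folklore] -/
def UniversalFactor.lehmerTailConst (t₀ : ℝ) : ℝ :=
  5 * Real.exp (Real.log (t₀ / 2) / 4 + 3 / 64 + π / 4 + 1)

/-- The exactly computable error factor of a quadrature rule with nodes `u j`, weights `W j` on
`[−ρ, ρ]`, Cauchy radius `R` and Taylor order `K` (the bracket of `quadrature_error_le`). [folklore] -/
def UniversalFactor.quadDefect {ι : Type*} (s : Finset ι) (u W : ι → ℝ) (ρ R : ℝ) (K : ℕ) : ℝ :=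
  ∑ n ∈ Finset.range (K + 1),
      |((ρ ^ (n + 1) - (-ρ) ^ (n + 1)) / (n + 1) - ∑ j ∈ s, W j * u j ^ n)| / R ^ n +
    (2 * ρ + ∑ j ∈ s, |W j|) * ((ρ / R) ^ (K + 1) / (1 - ρ / R))

/-- The disc constant `M_disc(T) = 5(T+1)³ exp(¼ + (log T + 3)/8 + D₀ + (−κ(T − t₀) + 8))`
(`R = ¼`, `|κ| = 32`). [folklore] -/
def UniversalFactor.lehmerMdisc (t₀ κ T D₀ : ℝ) : ℝ :=
  5 * (T + 1) ^ 3 * Real.exp (1 / 4 + (Real.log T + 3) * (1 / 4) / 2 + D₀ + (-κ * (T - t₀) + |κ| * (1 / 4)))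

/-- The segment constant `M_seg(T) = 25.3 (T+1)² exp((log T + 3)ρ/2 + D₀ + (−κ(T − t₀) + |κ|ρ))`.
[folklore] -/
def UniversalFactor.lehmerMseg (t₀ κ T ρ D₀ : ℝ) : ℝ :=
  253 / 10 * (T + 1) ^ 2 * Real.exp ((Real.log T + 3) * ρ / 2 + D₀ + (-κ * (T - t₀) + |κ| * ρ))

/-- Enclosure of `arctan (p/q)` for `2p ≤ q`, `q > 0`: `x − x³/3` widened by `2x⁵`. [folklore] -/
def UniversalFactor.atanSmall (S : ℕ) (p q : ℕ) : MI :=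
  (MI.ofFrac S (3 * (p : ℤ) * (q : ℤ) ^ 2 - (p : ℤ) ^ 3) (3 * q ^ 3)).widen
    (Numerics.cdiv (2 * (S : ℤ) * (p : ℤ) ^ 5) ((q : ℤ) ^ 5))

/-- `ℓ(t) = ½ log(1/16 + t²/4)`. [folklore] -/
def UniversalFactor.ellR (t : ℝ) : ℝ := Real.log (1 / 16 + t ^ 2 / 4) / 2

/-- `α(t) = π/2 − arctan(1/(2t))`. [folklore] -/
def UniversalFactor.alphaR (t : ℝ) : ℝ := π / 2 - Real.arctan (1 / (2 * t))

/-- `Re F(¼ + it/2) = −ℓ/4 − tα/2 − ¼`. [folklore] -/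
def UniversalFactor.reSPR (t : ℝ) : ℝ :=
  -UniversalFactor.ellR t / 4 - t * UniversalFactor.alphaR t / 2 - 1 / 4

/-- `Im F(¼ + it/2) = −α/4 + tℓ/2 − t/2`. [folklore] -/
def UniversalFactor.imSPR (t : ℝ) : ℝ :=
  -UniversalFactor.alphaR t / 4 + t * UniversalFactor.ellR t / 2 - t / 2

/-- Enclosure of `ℓ(a/b) = ½ (log(b² + 4a²) − log(16 b²))`. [folklore] -/
def UniversalFactor.ellOf (S K : ℕ) (a b : ℕ) : Option MI :=
  match MI.logNat S K (b ^ 2 + 4 * a ^ 2), MI.logNat S K (16 * b ^ 2) with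
  | some L1, some L2 => some ((L1.sub L2).divNat 2)
  | _, _ => none

/-- Enclosure of `α(a/b) = π/2 − arctan(b/(2a))` (`b ≤ a`). [folklore] -/
def UniversalFactor.alphaOf (S : ℕ) (piI : MI) (a b : ℕ) : MI :=
  (piI.divNat 2).sub (UniversalFactor.atanSmall S b (2 * a))

/-- Enclosures of `(Re F(¼ + it/2), Im F(¼ + it/2))` at `t = a/b`. [folklore] -/
def UniversalFactor.spOf (S K : ℕ) (piI : MI) (a b : ℕ) : Option (MI × MI) :=
  match UniversalFactor.ellOf S K a b with
  | none => none
  | some ell =>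
    let α := UniversalFactor.alphaOf S piI a b
    let t := MI.ofFrac S a b
    some ((((ell.divNat 4).neg.sub ((MI.mul S t α).divNat 2)).sub (MI.ofFrac S 1 4)),
      (((α.divNat 4).neg.add ((MI.mul S t ell).divNat 2)).sub (t.divNat 2)))

/-- Evaluation context: the `ζ`-tables (scale `T.S`, `T.piI ∋ π`), the series length for logarithms,
`t₀ = t0N/t0D`, and enclosures of `log π`, `φ(t₀) = thetaMain t₀`, `Re F(¼+it₀/2)`, `Im F(¼+it₀/2)`.
[folklore] -/
structure UniversalFactor.LCtx where
  /-- tables of the certified `ζ` evaluator -/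
  T : Tables
  /-- number of series terms for `logNat`/`logOneSub` -/
  Klog : ℕ
  /-- numerator of `t₀` -/
  t0N : ℕ
  /-- denominator of `t₀` -/
  t0D : ℕ
  /-- `∋ log π` -/
  logPi : MI
  /-- `∋ thetaMain t₀` -/
  theta0 : MI
  /-- `∋ Re F(¼ + it₀/2)` -/
  reSP0 : MI
  /-- `∋ Im F(¼ + it₀/2)` -/
  imSP0 : MI

/-- The real `t₀` of a context. [folklore] -/
noncomputable def UniversalFactor.LCtx.t0 (C : UniversalFactor.LCtx) : ℝ := (C.t0N : ℝ) / C.t0D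

/-- Validity certificate of a context: valid tables, `1 ≤ t₀`, and correct enclosures (a structure of
proofs, kept in `Type` so that it is plain data for the audit). [folklore] -/
structure UniversalFactor.LCtx.Valid (C : UniversalFactor.LCtx) : Type where
  /-- the `ζ`-tables are valid -/
  tv : C.T.Valid
  /-- `t0D > 0` -/
  t0D_pos : 0 < C.t0D
  /-- `t₀ ≥ 1` -/
  t0D_le : C.t0D ≤ C.t0N
  /-- `log π ∈ logPi` -/
  mem_logPi : MI.mem C.T.S (Real.log π) C.logPi
  /-- `thetaMain t₀ ∈ theta0` -/
  mem_theta0 : MI.mem C.T.S (UniversalFactor.thetaMain C.t0) C.theta0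
  /-- `Re F(¼+it₀/2) ∈ reSP0` -/
  mem_reSP0 : MI.mem C.T.S (UniversalFactor.reSPR C.t0) C.reSP0
  /-- `Im F(¼+it₀/2) ∈ imSP0` -/
  mem_imSP0 : MI.mem C.T.S (UniversalFactor.imSPR C.t0) C.imSP0

/-- Build a context from valid tables. [folklore] -/
def UniversalFactor.mkCtx (T : Tables) (Klog t0N t0D : ℕ) : Option UniversalFactor.LCtx :=
  if 0 < t0D ∧ t0D ≤ t0N then
    match MI.logTwo T.S Klog, MI.logOneSub T.S Klog ((MI.ofInt T.S 1).sub (T.piI.divNat 4)),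
      MI.logNat T.S Klog t0N, MI.logNat T.S Klog t0D, UniversalFactor.spOf T.S Klog T.piI t0N t0D with
    | some L2, some LP, some LN, some LD, some P =>
      let logPi := (L2.mulInt 2).add LP
      let t0 := MI.ofFrac T.S t0N t0D
      let theta0 := ((MI.mul T.S (t0.divNat 2) (((LN.sub LD).sub L2).sub logPi)).sub (t0.divNat 2)).sub
        (T.piI.divNat 8)
      some ⟨T, Klog, t0N, t0D, logPi, theta0, P.1, P.2⟩
    | _, _, _, _, _ => none
  else none

/-- Taylor terms for the real exponentials of the certificate (arguments up to `|x| ≤ 64`). [folklore] -/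
def UniversalFactor.KEXP : ℕ := 40

/-- Halvings for the real exponentials of the certificate (`x/2⁶ ∈ [−1, 1]`). [folklore] -/
def UniversalFactor.kEXP : ℕ := 6

/-- A complex box containing `lehmerF t₀ κ (½ + it)` at `t = a/b`: the product of the unit phase
(`expI`), the real factors `t² + ¼` and `e^{x}` (`exp`), and `zetaBox` at `½ + it`. [folklore] -/
def UniversalFactor.lehmerFBox (C : UniversalFactor.LCtx) (a b : ℕ) (κ : ℤ) : Option MC :=
  let S := C.T.S
  match zetaBox C.T ⟨MI.ofFrac S 1 2, MI.ofFrac S a b⟩, UniversalFactor.spOf S C.Klog C.T.piI a b with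
  | some Z, some P =>
    let t := MI.ofFrac S a b
    let t0 := MI.ofFrac S C.t0N C.t0D
    let dt := t.sub t0
    let mag := MI.ofFrac S (4 * (a : ℤ) ^ 2 + (b : ℤ) ^ 2) (4 * b ^ 2)
    let ex := (P.1.sub C.reSP0).sub (dt.mulInt κ)
    let ph := ((C.theta0.sub (MI.mul S (dt.divNat 2) C.logPi)).add P.2).sub C.imSP0
    match MI.exp S UniversalFactor.KEXP UniversalFactor.kEXP ex, MC.expI S C.T.KI C.T.kI C.T.piI ph with
    | some E, some U => some (MC.mul S ((U.mulMI S mag).mulMI S E) Z)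
    | _, _ => none
  | _, _ => none

end Summit.RiemannHypothesis.RiemannHypothesis.Theorems
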